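import Summits.QuantumFields.YangMills.Theorems.ColdStartUniversalityLatticeLangevinDuhamelFirstForm
import HarnessLib

/-!
# Route `ColdStartUniversality` (fixed-cut-off package): the ground-state Duhamel identity, SECOND form —
# the perturbation expansion can be run from either end

Helper file (seat `ym-line-csu-p1`, g15).  ABSTRACT measure theory on a compact space `X`, no SZZ object; step 2 of 3 of the
proof that the Shen–Zhu–Zhu lattice Langevin semigroup is REVERSIBLE with respect to the Wilson measure (SZZ, CMP 400 (2023)
§3 p. 13).  Notation as in `…DuhamelFirstForm`: `T_a u (x) = ∫ u d(κ⁰_a x)`, `q_a u (x) = ∫ φ u d(κ_a x)`.  From the FIRST form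

  `q_t w = φ · T_t w - ∫₀ᵗ q_s (V · T_{t-s} w) ds`                                 (D1, all continuous `w`)

we derive the SECOND form (`duhamel_second`)

  `q_t w = φ · T_t w - φ · ∫₀ᵗ T_{t-s} (V φ⁻¹ · q_s w) ds`.                         (D2)

Proof («Z-trick»): the right-hand side `Z_t w` of (D2) itself satisfies (D1) — expanding `q_r w` by (D1) under `T_{t-r}`
(`duhamel_first_expanded`) the two double integrals over the 2-simplex are exchanged by the shear `(r, u) ↦ (t-r+u, u)`
(`intervalIntegral_shear`) and the single integrals by `s = t - r` — and (D1) has at most one solution with the a-priori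
bound `|Y_s u| ≤ M sup|u|` (Picard/Grönwall: `|Z - q| ≤ M B (K t)ⁿ/n!` for every `n`).  Formally (D1)/(D2) are the two
variation-of-constants formulas `e^{tH} = e^{tL₀} - ∫₀ᵗ e^{sH} V e^{(t-s)L₀} ds = e^{tL₀} - ∫₀ᵗ e^{(t-s)L₀} V e^{sH} ds` for
`H = L₀ - V` conjugated by the ground state; no generator, domain or PDE regularity is used here.  No definition, no sorry.
RECORD-rung R3 plumbing; nothing here bears on the Yang–Mills mass gap.
-/

set_option autoImplicit false

noncomputable section

namespace Summit.QuantumFields.YangMills.Theorems.ColdStartUniversality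

open MeasureTheory ProbabilityTheory Filter Topology Set
open scoped NNReal

variable {X : Type*} [TopologicalSpace X] [CompactSpace X] [MeasurableSpace X] [BorelSpace X]

/-- **(D2) — the second Duhamel form.**  See the module docstring. [folklore] -/
theorem duhamel_second (κ κ₀ : ℝ≥0 → Kernel X X) [∀ t, IsMarkovKernel (κ t)] [∀ t, IsMarkovKernel (κ₀ t)]
    (hK : ∀ G : X → ℝ, Continuous G → Continuous fun p : ℝ≥0 × X => ∫ y, G y ∂(κ p.1 p.2))
    (hT : ∀ G : X → ℝ, Continuous G → Continuous fun p : ℝ≥0 × X => ∫ y, G y ∂(κ₀ p.1 p.2))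
    {φ V : X → ℝ} (hφc : Continuous φ) (hφpos : ∀ x, 0 < φ x) (hVc : Continuous V)
    (hD : ∀ w : X → ℝ, Continuous w → ∀ (t : ℝ≥0) (x : X),
      ∫ y, φ y * w y ∂(κ t x) = φ x * ∫ y, w y ∂(κ₀ t x) -
        ∫ s in (0 : ℝ)..(t : ℝ), ∫ y, φ y * (V y * ∫ z, w z ∂(κ₀ ((t : ℝ) - s).toNNReal y)) ∂(κ s.toNNReal x))
    {w : X → ℝ} (hw : Continuous w) (t : ℝ≥0) (x : X) :
    ∫ y, φ y * w y ∂(κ t x) = φ x * ∫ y, w y ∂(κ₀ t x) -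
      φ x * ∫ s in (0 : ℝ)..(t : ℝ),
        (∫ y, V y * (φ y)⁻¹ * (∫ z, φ z * w z ∂(κ s.toNNReal y)) ∂(κ₀ ((t : ℝ) - s).toNNReal x)) := by
  have hφne : ∀ y, φ y ≠ 0 := fun y => (hφpos y).ne'
  have hφic : Continuous fun y => (φ y)⁻¹ := hφc.inv₀ hφne
  obtain ⟨Φ, hΦ0, hΦ⟩ := exists_abs_le_of_continuous_of_compactSpace hφc
  obtain ⟨φ₀, hφ₀, hφ₀le⟩ := exists_pos_le_of_continuous_of_compactSpace hφc hφpos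
  obtain ⟨K, hK0, hKV⟩ := exists_abs_le_of_continuous_of_compactSpace hVc
  have hφi : ∀ y, |(φ y)⁻¹| ≤ φ₀⁻¹ := fun y => by
    rw [abs_inv, abs_of_pos (hφpos y)]; exact inv_anti₀ hφ₀ (hφ₀le y)
  -- ### the operators in real time: `T a u x`, `q a u x`, `Z a u x`
  set T : ℝ → (X → ℝ) → X → ℝ := fun a u x => ∫ y, u y ∂(κ₀ a.toNNReal x) with hTdef
  set q : ℝ → (X → ℝ) → X → ℝ := fun a u x => ∫ y, φ y * u y ∂(κ a.toNNReal x) with hqdef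
  set Z : ℝ → (X → ℝ) → X → ℝ := fun a u x =>
    φ x * T a u x - φ x * ∫ s in (0 : ℝ)..a, T (a - s) (fun y => V y * (φ y)⁻¹ * q s u y) x with hZdef
  -- ### continuity lemmas: the two actions on jointly continuous families
  have hTfam : ∀ {P : Type} [TopologicalSpace P] {u : P → X → ℝ}, Continuous (Function.uncurry u) →
      ∀ {τ : P → ℝ}, Continuous τ → Continuous fun r : P × X => T (τ r.1) (u r.1) r.2 :=
    fun hu _ hτ => continuous_refAction_family κ₀ hT hu hτ
  have hqfam : ∀ {P : Type} [TopologicalSpace P] {u : P → X → ℝ}, Continuous (Function.uncurry u) →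
      ∀ {τ : P → ℝ}, Continuous τ → Continuous fun r : P × X => q (τ r.1) (u r.1) r.2 :=
    fun hu _ hτ => continuous_gsAction_family κ hK hφc hu hτ
  -- bounds
  have hTbd : ∀ (a : ℝ) {u : X → ℝ} {B : ℝ}, (∀ y, |u y| ≤ B) → ∀ x, |T a u x| ≤ B :=
    fun a u B hu x => abs_integral_le_of_abs_le_of_isProbabilityMeasure hu
  have hqbd : ∀ (a : ℝ) {u : X → ℝ} {B : ℝ}, 0 ≤ B → (∀ y, |u y| ≤ B) → ∀ x, |q a u x| ≤ Φ * B :=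
    fun a u B hB hu x => abs_integral_le_of_abs_le_of_isProbabilityMeasure fun y => by
      rw [abs_mul]; exact mul_le_mul (hΦ y) (hu y) (abs_nonneg _) hΦ0
  -- ### (D1) in real time
  have hD1 : ∀ {u : X → ℝ}, Continuous u → ∀ {r : ℝ}, 0 ≤ r → ∀ x,
      q r u x = φ x * T r u x - ∫ s in (0 : ℝ)..r, q s (fun y => V y * T (r - s) u y) x := by
    intro u hu r hr x
    have h := hD u hu r.toNNReal x
    rw [Real.coe_toNNReal r hr] at h
    exact h
  -- ### the moving observable `G s = V · T_{t'-s} u` of (D1)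
  have hGc : ∀ (t' : ℝ) {u : X → ℝ}, Continuous u →
      Continuous (Function.uncurry fun (s : ℝ) (y : X) => V y * T (t' - s) u y) := by
    intro t' u hu
    have h1 : Continuous fun r : ℝ × X => T (t' - r.1) u r.2 :=
      hTfam (u := fun (_ : ℝ) (z : X) => u z) (hu.comp continuous_snd) (continuous_const.sub continuous_id)
    exact (hVc.comp continuous_snd).mul h1
  have hGbd : ∀ (t' s : ℝ) {u : X → ℝ} {B : ℝ}, 0 ≤ B → (∀ y, |u y| ≤ B) → ∀ y, |V y * T (t' - s) u y| ≤ K * B := by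
    intro t' s u B hB hu y
    rw [abs_mul]; exact mul_le_mul (hKV y) (hTbd _ hu y) (abs_nonneg _) hK0
  -- the correction integrand of `Z` on a family: `((p, r), x) ↦ T (σ p - r) (V φ⁻¹ q r (u p)) x` is jointly continuous
  have hZint : ∀ {P : Type} [TopologicalSpace P] {u : P → X → ℝ}, Continuous (Function.uncurry u) →
      ∀ {σ : P → ℝ}, Continuous σ →
      Continuous fun r : (P × ℝ) × X => T (σ r.1.1 - r.1.2) (fun y => V y * (φ y)⁻¹ * q r.1.2 (u r.1.1) y) r.2 := by
    intro P _ u hu σ hσ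
    have h1 : Continuous (Function.uncurry fun (p : P × ℝ) (y : X) => V y * (φ y)⁻¹ * q p.2 (u p.1) y) := by
      have hq1 : Continuous fun r : (P × ℝ) × X => q r.1.2 (u r.1.1) r.2 :=
        hqfam (u := fun (p : P × ℝ) (y : X) => u p.1 y)
          (hu.comp ((continuous_fst.comp continuous_fst).prodMk continuous_snd)) continuous_snd
      exact ((hVc.comp continuous_snd).mul (hφic.comp continuous_snd)).mul hq1
    exact hTfam h1 ((hσ.comp continuous_fst).sub continuous_snd)
  -- `(p, x) ↦ Z (σ p) (u p) x` is jointly continuous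
  have hZfam : ∀ {P : Type} [TopologicalSpace P] {u : P → X → ℝ}, Continuous (Function.uncurry u) →
      ∀ {σ : P → ℝ}, Continuous σ → Continuous fun r : P × X => Z (σ r.1) (u r.1) r.2 := by
    intro P _ u hu σ hσ
    have h1 : Continuous fun r : P × X => φ r.2 * T (σ r.1) (u r.1) r.2 := (hφc.comp continuous_snd).mul (hTfam hu hσ)
    have h2 : Continuous fun r : P × X =>
        ∫ s in (0 : ℝ)..σ r.1, T (σ r.1 - s) (fun y => V y * (φ y)⁻¹ * q s (u r.1) y) r.2 := by
      have h := hZint hu hσ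
      have h' : Continuous (Function.uncurry fun (r : P × X) (s : ℝ) =>
          T (σ r.1 - s) (fun y => V y * (φ y)⁻¹ * q s (u r.1) y) r.2) :=
        h.comp (((continuous_fst.comp continuous_fst).prodMk continuous_snd).prodMk (continuous_snd.comp continuous_fst))
      exact intervalIntegral.continuous_parametric_intervalIntegral_of_continuous h' (hσ.comp continuous_fst)
    show Continuous fun r : P × X => φ r.2 * T (σ r.1) (u r.1) r.2 -
      φ r.2 * ∫ s in (0 : ℝ)..σ r.1, T (σ r.1 - s) (fun y => V y * (φ y)⁻¹ * q s (u r.1) y) r.2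
    exact h1.sub ((hφc.comp continuous_snd).mul h2)
  -- ### `Z` satisfies the first form (D1)
  have hZ1 : ∀ {u : X → ℝ}, Continuous u → ∀ {t' : ℝ}, 0 ≤ t' → ∀ x,
      Z t' u x = φ x * T t' u x - ∫ s in (0 : ℝ)..t', Z s (fun y => V y * T (t' - s) u y) x := by
    intro u hu t' ht' x
    -- the triple-gap integrand `h a b c = T_a (V φ⁻¹ q_b (V T_c u)) (x)` of the two double integrals
    set h : ℝ → ℝ → ℝ → ℝ := fun a b c =>
      T a (fun y => V y * (φ y)⁻¹ * q b (fun z => V z * T c u z) y) x with hhdef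
    have hfam : Continuous (Function.uncurry fun (p : ℝ × ℝ) (y : X) =>
        V y * (φ y)⁻¹ * q p.1 (fun z => V z * T p.2 u z) y) := by
      have hin : Continuous (Function.uncurry fun (c : ℝ) (z : X) => V z * T c u z) := by
        have h1 : Continuous fun r : ℝ × X => T r.1 u r.2 :=
          hTfam (u := fun (_ : ℝ) (z : X) => u z) (hu.comp continuous_snd) continuous_id
        exact (hVc.comp continuous_snd).mul h1
      have hq1 : Continuous fun r : (ℝ × ℝ) × X => q r.1.1 (fun z => V z * T r.1.2 u z) r.2 :=
        hqfam (u := fun (p : ℝ × ℝ) (z : X) => V z * T p.2 u z)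
          (hin.comp ((continuous_snd.comp continuous_fst).prodMk continuous_snd)) continuous_fst
      exact ((hVc.comp continuous_snd).mul (hφic.comp continuous_snd)).mul hq1
    have hhc : Continuous fun p : ℝ × ℝ × ℝ => h p.1 p.2.1 p.2.2 := by
      have hT1 : Continuous fun r : (ℝ × (ℝ × ℝ)) × X =>
          T r.1.1 (fun y => V y * (φ y)⁻¹ * q r.1.2.1 (fun z => V z * T r.1.2.2 u z) y) r.2 :=
        hTfam (u := fun (p : ℝ × (ℝ × ℝ)) (y : X) => V y * (φ y)⁻¹ * q p.2.1 (fun z => V z * T p.2.2 u z) y)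
          (hfam.comp ((continuous_snd.comp continuous_fst).prodMk continuous_snd)) continuous_fst
      exact hT1.comp (continuous_id.prodMk continuous_const)
    -- expand the integrand of the left-hand side by (D1'):
    have hexp : ∀ r ∈ Icc (0 : ℝ) t', T (t' - r) (fun y => V y * (φ y)⁻¹ * q r u y) x =
        T (t' - r) (fun y => V y * T r u y) x - ∫ v in (0 : ℝ)..r, h (t' - r) v (r - v) := by
      intro r hr
      exact duhamel_first_expanded κ κ₀ hK hT hφc hφpos hVc hD hu hr.1 ((t' - r).toNNReal) x
    -- continuity of the pieces
    have hc1 : Continuous fun r : ℝ => T (t' - r) (fun y => V y * T r u y) x := by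
      have hin : Continuous (Function.uncurry fun (r : ℝ) (y : X) => V y * T r u y) := by
        have h1 : Continuous fun p : ℝ × X => T p.1 u p.2 :=
          hTfam (u := fun (_ : ℝ) (z : X) => u z) (hu.comp continuous_snd) continuous_id
        exact (hVc.comp continuous_snd).mul h1
      exact (hTfam hin (continuous_const.sub continuous_id)).comp (continuous_id.prodMk continuous_const)
    have hc2 : Continuous fun r : ℝ => ∫ v in (0 : ℝ)..r, h (t' - r) v (r - v) := by
      have h' : Continuous (Function.uncurry fun (r v : ℝ) => h (t' - r) v (r - v)) :=
        hhc.comp ((continuous_const.sub continuous_fst).prodMk (continuous_snd.prodMk (continuous_fst.sub continuous_snd)))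
      exact intervalIntegral.continuous_parametric_intervalIntegral_of_continuous h' continuous_id
    have hc3 : Continuous fun s : ℝ => T s (fun y => V y * T (t' - s) u y) x :=
      (hTfam (hGc t' hu) continuous_id).comp (continuous_id.prodMk continuous_const)
    have hc4 : Continuous fun s : ℝ => ∫ v in (0 : ℝ)..s, h (s - v) v (t' - s) := by
      have h' : Continuous (Function.uncurry fun (s v : ℝ) => h (s - v) v (t' - s)) :=
        hhc.comp ((continuous_fst.sub continuous_snd).prodMk (continuous_snd.prodMk (continuous_const.sub continuous_fst)))
      exact intervalIntegral.continuous_parametric_intervalIntegral_of_continuous h' continuous_id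
    -- left-hand side: `∫₀ᵗ' T_{t'-r}(V φ⁻¹ q_r u) dr = I₁ - I₂`
    have eL : ∫ r in (0 : ℝ)..t', T (t' - r) (fun y => V y * (φ y)⁻¹ * q r u y) x =
        (∫ r in (0 : ℝ)..t', T (t' - r) (fun y => V y * T r u y) x) -
          ∫ r in (0 : ℝ)..t', ∫ v in (0 : ℝ)..r, h (t' - r) v (r - v) := by
      rw [← intervalIntegral.integral_sub (hc1.intervalIntegrable _ _) (hc2.intervalIntegrable _ _)]
      refine intervalIntegral.integral_congr fun r hr => ?_
      rw [uIcc_of_le ht'] at hr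
      exact hexp r hr
    -- right-hand side: `∫₀ᵗ' Z_s (G s) ds = φ(x) I₁' - φ(x) I₂'`
    have eZs : ∀ s, Z s (fun y => V y * T (t' - s) u y) x =
        φ x * T s (fun y => V y * T (t' - s) u y) x - φ x * ∫ v in (0 : ℝ)..s, h (s - v) v (t' - s) := fun s => rfl
    have eR : ∫ s in (0 : ℝ)..t', Z s (fun y => V y * T (t' - s) u y) x =
        φ x * (∫ s in (0 : ℝ)..t', T s (fun y => V y * T (t' - s) u y) x) -
          φ x * ∫ s in (0 : ℝ)..t', ∫ v in (0 : ℝ)..s, h (s - v) v (t' - s) := by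
      simp_rw [eZs]
      rw [intervalIntegral.integral_sub ((hc3.const_mul _).intervalIntegrable _ _)
        ((hc4.const_mul _).intervalIntegrable _ _), intervalIntegral.integral_const_mul,
        intervalIntegral.integral_const_mul]
    -- single integrals agree by `s = t' - r`
    have e1 : ∫ r in (0 : ℝ)..t', T (t' - r) (fun y => V y * T r u y) x =
        ∫ s in (0 : ℝ)..t', T s (fun y => V y * T (t' - s) u y) x := by
      have hsub := intervalIntegral.integral_comp_sub_left (fun s : ℝ => T s (fun y => V y * T (t' - s) u y) x) t'
        (a := 0) (b := t')
      simp only [sub_self, sub_zero, sub_sub_cancel] at hsub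
      exact hsub
    -- double integrals agree by the shear of the simplex
    have e2 : ∫ r in (0 : ℝ)..t', ∫ v in (0 : ℝ)..r, h (t' - r) v (r - v) =
        ∫ s in (0 : ℝ)..t', ∫ v in (0 : ℝ)..s, h (s - v) v (t' - s) := intervalIntegral_shear hhc ht'
    -- assemble
    show φ x * T t' u x - φ x * ∫ s in (0 : ℝ)..t', T (t' - s) (fun y => V y * (φ y)⁻¹ * q s u y) x =
      φ x * T t' u x - ∫ s in (0 : ℝ)..t', Z s (fun y => V y * T (t' - s) u y) x
    rw [eR, eL, e1, e2]
    ring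
  -- ### uniqueness for (D1): `Z = q` (Picard/Grönwall)
  set t₀ : ℝ := (t : ℝ) with ht₀
  have ht₀0 : 0 ≤ t₀ := t.2
  set M : ℝ := Φ * (2 + t₀ * (K * φ₀⁻¹ * Φ)) with hM
  have hM0 : 0 ≤ M := by positivity
  -- a-priori bound of the correction integrand
  have hcorr_bd : ∀ (s : ℝ) {u : X → ℝ} {B : ℝ}, 0 ≤ B → (∀ y, |u y| ≤ B) →
      ∀ (a : ℝ) x, |T a (fun y => V y * (φ y)⁻¹ * q s u y) x| ≤ K * φ₀⁻¹ * Φ * B := by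
    intro s u B hB hu a x
    refine hTbd a (fun y => ?_) x
    rw [abs_mul, abs_mul]
    calc |V y| * |(φ y)⁻¹| * |q s u y| ≤ K * φ₀⁻¹ * (Φ * B) :=
          mul_le_mul (mul_le_mul (hKV y) (hφi y) (abs_nonneg _) hK0) (hqbd s hB hu y) (abs_nonneg _) (by positivity)
      _ = K * φ₀⁻¹ * Φ * B := by ring
  have hZbd : ∀ {u : X → ℝ} {B : ℝ}, 0 ≤ B → (∀ y, |u y| ≤ B) → ∀ s ∈ Icc (0 : ℝ) t₀, ∀ x,
      |Z s u x| ≤ Φ * B * (1 + t₀ * (K * φ₀⁻¹ * Φ)) := by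
    intro u B hB hu s hs x
    have h1 : |φ x * T s u x| ≤ Φ * B := by
      rw [abs_mul]; exact mul_le_mul (hΦ x) (hTbd s hu x) (abs_nonneg _) hΦ0
    have h2 : |∫ r in (0 : ℝ)..s, T (s - r) (fun y => V y * (φ y)⁻¹ * q r u y) x| ≤ K * φ₀⁻¹ * Φ * B * s := by
      have h := intervalIntegral.norm_integral_le_of_norm_le_const (a := (0 : ℝ)) (b := s)
        (f := fun r => T (s - r) (fun y => V y * (φ y)⁻¹ * q r u y) x) (C := K * φ₀⁻¹ * Φ * B)
        fun r _ => by rw [Real.norm_eq_abs]; exact hcorr_bd r hB hu (s - r) x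
      rwa [Real.norm_eq_abs, sub_zero, abs_of_nonneg hs.1] at h
    have h3 : |φ x * ∫ r in (0 : ℝ)..s, T (s - r) (fun y => V y * (φ y)⁻¹ * q r u y) x| ≤ Φ * (K * φ₀⁻¹ * Φ * B * t₀) := by
      rw [abs_mul]
      refine mul_le_mul (hΦ x) (h2.trans ?_) (abs_nonneg _) hΦ0
      exact mul_le_mul_of_nonneg_left hs.2 (by positivity)
    calc |Z s u x| ≤ |φ x * T s u x| + |φ x * ∫ r in (0 : ℝ)..s, T (s - r) (fun y => V y * (φ y)⁻¹ * q r u y) x| :=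
          abs_sub _ _
      _ ≤ Φ * B + Φ * (K * φ₀⁻¹ * Φ * B * t₀) := add_le_add h1 h3
      _ = Φ * B * (1 + t₀ * (K * φ₀⁻¹ * Φ)) := by ring
  -- the Picard bound
  have hP : ∀ n : ℕ, ∀ {u : X → ℝ}, Continuous u → ∀ {B : ℝ}, 0 ≤ B → (∀ y, |u y| ≤ B) →
      ∀ s ∈ Icc (0 : ℝ) t₀, ∀ x, |Z s u x - q s u x| ≤ M * B * (K * s) ^ n / n.factorial := by
    intro n
    induction n with
    | zero =>
      intro u hu B hB hub s hs x
      rw [pow_zero, Nat.factorial_zero, Nat.cast_one, div_one, mul_one]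
      calc |Z s u x - q s u x| ≤ |Z s u x| + |q s u x| := abs_sub _ _
        _ ≤ Φ * B * (1 + t₀ * (K * φ₀⁻¹ * Φ)) + Φ * B := add_le_add (hZbd hB hub s hs x) (hqbd s hB hub x)
        _ = M * B := by rw [hM]; ring
    | succ n ih =>
      intro u hu B hB hub s hs x
      -- both `Z` and `q` satisfy (D1) at time `s`
      have hZs := hZ1 hu hs.1 x
      have hqs := hD1 hu hs.1 x
      have hcZ : Continuous fun r : ℝ => Z r (fun y => V y * T (s - r) u y) x :=
        (hZfam (hGc s hu) continuous_id).comp (continuous_id.prodMk continuous_const)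
      have hcq : Continuous fun r : ℝ => q r (fun y => V y * T (s - r) u y) x :=
        (hqfam (hGc s hu) continuous_id).comp (continuous_id.prodMk continuous_const)
      have hdiff : Z s u x - q s u x =
          -∫ r in (0 : ℝ)..s, (Z r (fun y => V y * T (s - r) u y) x - q r (fun y => V y * T (s - r) u y) x) := by
        rw [hZs, hqs, intervalIntegral.integral_sub (hcZ.intervalIntegrable _ _) (hcq.intervalIntegrable _ _)]
        ring
      -- pointwise bound of the integrand from the induction hypothesis
      set A : ℝ := M * (K * B) * K ^ n / n.factorial with hA
      have hbd : ∀ r ∈ Ioc (0 : ℝ) s,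
          |Z r (fun y => V y * T (s - r) u y) x - q r (fun y => V y * T (s - r) u y) x| ≤ A * r ^ n := by
        intro r hr
        have hr' : r ∈ Icc (0 : ℝ) t₀ := ⟨hr.1.le, hr.2.trans hs.2⟩
        have hcs : Continuous fun y => V y * T (s - r) u y := hVc.mul (continuous_refAction κ₀ hT hu (s - r))
        have h := ih hcs (B := K * B) (by positivity) (hGbd s r hB hub) r hr' x
        calc _ ≤ M * (K * B) * (K * r) ^ n / n.factorial := h
          _ = A * r ^ n := by rw [hA, mul_pow]; ring
      have hIle : |∫ r in (0 : ℝ)..s, (Z r (fun y => V y * T (s - r) u y) x - q r (fun y => V y * T (s - r) u y) x)| ≤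
          ∫ r in (0 : ℝ)..s, A * r ^ n := by
        have h := intervalIntegral.norm_integral_le_of_norm_le (μ := volume) hs.1
          (f := fun r => Z r (fun y => V y * T (s - r) u y) x - q r (fun y => V y * T (s - r) u y) x)
          (g := fun r => A * r ^ n) (Eventually.of_forall fun r hr => by rw [Real.norm_eq_abs]; exact hbd r hr)
          ((continuous_const.mul (continuous_pow n)).intervalIntegrable _ _)
        rwa [Real.norm_eq_abs] at h
      have hIval : ∫ r in (0 : ℝ)..s, A * r ^ n = M * B * (K * s) ^ (n + 1) / (n + 1).factorial := by
        rw [intervalIntegral.integral_const_mul, integral_pow, hA, Nat.factorial_succ, Nat.cast_mul, Nat.cast_add,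
          Nat.cast_one, mul_pow, pow_succ, pow_succ]
        have hn : (n.factorial : ℝ) ≠ 0 := by positivity
        have hn1 : ((n : ℝ) + 1) ≠ 0 := by positivity
        field_simp
        ring
      rw [hdiff, abs_neg]
      exact hIle.trans hIval.le
  -- ### `n → ∞` at the time `t`
  obtain ⟨B, hB0, hB⟩ := exists_abs_le_of_continuous_of_compactSpace hw
  have hmem : t₀ ∈ Icc (0 : ℝ) t₀ := ⟨ht₀0, le_rfl⟩
  have hlim : Tendsto (fun n : ℕ => M * B * (K * t₀) ^ n / n.factorial) atTop (𝓝 0) := by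
    have h := (FloorSemiring.tendsto_pow_div_factorial_atTop (K * t₀)).const_mul (M * B)
    rw [mul_zero] at h
    refine h.congr fun n => ?_
    ring
  have hle : |Z t₀ w x - q t₀ w x| ≤ 0 := ge_of_tendsto' hlim fun n => hP n hw hB0 hB t₀ hmem x
  have hZq : Z t₀ w x = q t₀ w x := sub_eq_zero.1 (abs_eq_zero.1 (le_antisymm hle (abs_nonneg _)))
  -- ### read off (D2)
  have hq : q t₀ w x = ∫ y, φ y * w y ∂(κ t x) := by
    show ∫ y, φ y * w y ∂(κ t₀.toNNReal x) = _
    rw [ht₀, Real.toNNReal_coe]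
  have hZ : Z t₀ w x = φ x * ∫ y, w y ∂(κ₀ t x) -
      φ x * ∫ s in (0 : ℝ)..(t : ℝ),
        (∫ y, V y * (φ y)⁻¹ * (∫ z, φ z * w z ∂(κ s.toNNReal y)) ∂(κ₀ ((t : ℝ) - s).toNNReal x)) := by
    show φ x * (∫ y, w y ∂(κ₀ t₀.toNNReal x)) -
      φ x * ∫ s in (0 : ℝ)..t₀, (∫ y, V y * (φ y)⁻¹ * (∫ z, φ z * w z ∂(κ s.toNNReal y)) ∂(κ₀ (t₀ - s).toNNReal x)) = _
    rw [ht₀, Real.toNNReal_coe]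
  rw [← hq, ← hZq, hZ]

end Summit.QuantumFields.YangMills.Theorems.ColdStartUniversality

end
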